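import Mathlib
import HarnessLib
import Summits.HubbardSuperconductivity.HubbardSuperconductivity.Theorems.KLProgrammeKLRegimeEngineTowerRemeasureLev
import Summits.HubbardSuperconductivity.HubbardSuperconductivity.Theorems.KLProgrammeH10TwoPointLimitKlAnisoAbsUmklappCount34Window
import Summits.HubbardSuperconductivity.HubbardSuperconductivity.Theorems.KLProgrammeKLRegimeEngineTowerRemeasureLevAbs

/-!
# Route `KLProgramme` — crux K3 ENGINE (stmt-HubbardSuperconductivity-20437 `KLRegimeEngineV17F2`), stub (b) v2, THE LEVELS PACKAGE (ℓ), instantiation (I2),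
# THE JUMP HALF WITH THE SECOND CONSERVATION GAIN IN THE 3–4-FREE-LEG CELLS — `C_m·(J′+1)·(2^{J′})^{(m+1) − max(F,1) − 2}` for `levelCount Ωe + 4 ≤ m + 1`
# (located item «UV-REMEASURE-COUNT», decision (b), count «ABS-UMK-34-SIGNPAT»)

Cell gate-hubbard-kl, seat p4 g16 (count side; consumer-side twin OFFERED to the k3c2-p3 / E1 lineages).  As `…EngineTowerRemeasureLevAbs`
(`klLevNormOf_jump_le_of_consts_abs`, condition `levelCount Ωe + 6 ≤ m + 1`), with the count `PerturbedFermiCurve.card_relCount34_prescribed_absUmklapp_klAniso_le_window`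
(≥ 3 free legs, one logarithm `J′ + 1`): the leg set of the `L¹–L^∞` norm always contains the pinned leg, so it is nonempty and has `≤ levelCount Ωe + 1` elements;
the condition becomes `levelCount Ωe + 4 ≤ m + 1` — e.g. `2p = 6` at levels `F ≤ 2`, `2p = 8` at `F ≤ 4`:

* **`klLevNormOf_jump_le_of_consts_abs34`**, **`klLevNormOf_jump_le_klEng_abs34`**, **`klLevNormOf_scaleZero_remeasure_le_klEng_abs34`** —
  `klLevNormOf … J′ (m+1) 𝒱_0 Ωe ≤ C_m·(J′+1)·(2^{J′})^{(m+1) − max(levelCount Ωe, 1) − 2}·N₀` for `levelCount Ωe + 4 ≤ m + 1`.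
Everything is proved; no definitions; nothing about the model is asserted; nothing asserts superconductivity.
References: BGM 2006 §2.8 (2.76), (2.82)–(2.84), (2.88)–(2.90), App. A3 Lemma A3.1 [cite: BenfattoGiulianiMastropietro2006]; BGM 2003 §3.1 Lemma 3.1 (4.3)
[cite: BenfattoGiulianiMastropietro2003].
-/

noncomputable section

namespace Summit.HubbardSuperconductivity.HubbardSuperconductivity.Theorems.EngineV8

set_option linter.dupNamespace false -- summit = problem name (single-conjunct summit), D-0017

open Classical
open Real Finset Literature.MathematicalPhysics.QuantumLattice Literature.Probability.LatticeModels GrassmannAlgebra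
open Literature.MathematicalPhysics.QuantumLattice.FermiRG
open Summit.HubbardSuperconductivity.HubbardSuperconductivity.Theorems.KLRegimeSplit
open Summit.HubbardSuperconductivity.HubbardSuperconductivity.Theorems.KLProgrammeLegKernels
open Summit.HubbardSuperconductivity.HubbardSuperconductivity.Theorems.DispersionFlow
open Summit.HubbardSuperconductivity.HubbardSuperconductivity.Theorems.KLRegimeWick
open Summit.HubbardSuperconductivity.HubbardSuperconductivity.Theorems.TorusFourierL2
open Summit.HubbardSuperconductivity.HubbardSuperconductivity.Theorems.PerturbedFermiCurve

variable {L M : ℕ} [NeZero L] [NeZero M]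

/-! ## §1 The jump at abstract overlap constants, absolute count, ≥ 3 free legs -/

/-- **THE LEVELLED JUMP at abstract constants WITH THE ABSOLUTE COUNT, ≥ 3 free legs** (BGM 2006 (2.82)–(2.84), (2.88)–(2.90); BGM 2003 Lemma 3.1).  As
`klLevNormOf_jump_le_of_consts`, with the counting hypothesis replaced by the absolute count with the second conservation gain
(`#{…} ≤ D^{m+1}·(J′+1)·(2^{J′})^{(m+1)−|E|−2}` for `|E| + 3 ≤ m + 1`, `E ≠ ∅`): for `levelCount Ωe + 4 ≤ m + 1`,
`klLevNormOf … J′ (m+1) T Ωe ≤ c₁^m·c₁r·ε^{m+1}·(D^{m+1}·27^{m+1})·(J′+1)·(2^{J′})^{(m+1) − max(levelCount Ωe, 1) − 2}·N`.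
[cite: BenfattoGiulianiMastropietro2006, §2.8 (2.82)-(2.84), (2.88)-(2.90); BenfattoGiulianiMastropietro2003, §3.1 Lemma 3.1 (4.3)] -/
theorem klLevNormOf_jump_le_of_consts_abs34 {β : ℝ} (hβ : 0 < β) (μ : ℝ) (K : TrigPolyC4v) {k J' : ℕ} (hJ : k + 1 ≤ J')
    (T : HubbardGrassmann L M)
    (hT : ∀ (m : ℕ) (X : Fin m → HubbardFieldIdx L M), ∑ i, signedMomentum L (X i).2 (X i).1.1.2 ≠ 0 → kernel ℂ T m X = 0)
    {c₁ c₁r D : ℝ} (hc₁0 : 0 ≤ c₁) (hc₁r0 : 0 ≤ c₁r) (hD : 0 ≤ D)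
    (hcol₁ : ∀ (ω'' : Fin (sectorCount J')) (ω' : Fin (sectorCount k)) (σ c : Fin 2) (x' : SpaceTimeIdx L M),
      ∑ x'' : SpaceTimeIdx L M, ‖(sectorAnalysisMatrix L M β (klAnisoFamily L M β μ K klE0 J') *
        sectorSubMatrix L M β (bgmFatMultiplier L M klE0 β (nambuXiCT L μ K) k)) (x'', ((ω'', σ), c)) (x', ((ω', σ), c))‖ ≤ c₁)
    (hrow₁ : ∀ (ω'' : Fin (sectorCount J')) (ω' : Fin (sectorCount k)) (σ c : Fin 2) (x'' : SpaceTimeIdx L M),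
      ∑ x' : SpaceTimeIdx L M, ‖(sectorAnalysisMatrix L M β (klAnisoFamily L M β μ K klE0 J') *
        sectorSubMatrix L M β (bgmFatMultiplier L M klE0 β (nambuXiCT L μ K) k)) (x'', ((ω'', σ), c)) (x', ((ω', σ), c))‖ ≤ c₁r)
    (m : ℕ)
    (hcnt : ∀ (E : Finset (Fin (m + 1))) (τ'' : Fin (m + 1) → SectorLeg (sectorCount J'))
      (σ' : Fin (m + 1) → SectorLeg (sectorCount k)), E.card + 3 ≤ m + 1 → E.Nonempty →
      ((((bgmSectorSet L M (klAnisoFamily L M β μ K klE0 J') (m + 1)).filter fun σ'' => (∀ e ∈ E, σ'' e = τ'' e) ∧ ∀ i,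
        (∃ q : FreqMomentum L M, klAnisoFamily L M β μ K klE0 J' (σ'' i).1.1 q ≠ 0 ∧
          bgmFatMultiplier L M klE0 β (nambuXiCT L μ K) k (σ' i).1.1 q ≠ 0) ∧
        (σ' i).1.2 = (σ'' i).1.2 ∧ (σ' i).2 = (σ'' i).2).card : ℝ)) ≤
        D ^ (m + 1) * ((J' : ℝ) + 1) * ((2 : ℝ) ^ J') ^ ((m + 1) - E.card - 2))
    (Ωe : Fin (m + 1) → Option (SectorLeg (sectorCount J'))) (hlev : levelCount Ωe + 4 ≤ m + 1) {N : ℝ} (hN0 : 0 ≤ N)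
    (hN : ∀ Ωe' : Fin (m + 1) → Option (SectorLeg (sectorCount k)), levelCount Ωe' = levelCount Ωe →
      klLevNormOf L M β μ K k (m + 1) T Ωe' ≤ N) :
    klLevNormOf L M β μ K J' (m + 1) T Ωe ≤
      c₁ ^ m * c₁r * imagTimeWeight β M ^ (m + 1) * (D ^ (m + 1) * 27 ^ (m + 1)) * ((J' : ℝ) + 1) *
        ((2 : ℝ) ^ J') ^ ((m + 1) - max (levelCount Ωe) 1 - 2) * N := by
  have hJ0 : (0 : ℝ) ≤ (J' : ℝ) + 1 := by positivity
  have hε0 : 0 ≤ imagTimeWeight β M := imagTimeWeight_nonneg hβ.le M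
  set ε := imagTimeWeight β M with hεdef
  set F' := klAnisoFamily L M β μ K klE0 J' with hF'
  set Fk := klAnisoFamily L M β μ K klE0 k with hFk
  have hC : 0 ≤ c₁ ^ m * c₁r * ε ^ (m + 1) * (D ^ (m + 1) * 27 ^ (m + 1)) * ((J' : ℝ) + 1) *
      ((2 : ℝ) ^ J') ^ ((m + 1) - max (levelCount Ωe) 1 - 2) * N := by
    positivity
  rw [klLevNormOf, hubbardSectorKernelNorm_def]
  refine sectorisedKernelNorm_le_of_forall_le hC fun p s x => ?_
  -- the leg set and the fine prescription read by the leg sum at `(p, s)`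
  set E : Finset (Fin (m + 1)) := univ.filter fun i => (Ωe i).isSome ∨ i = p with hE
  set τ'' : Fin (m + 1) → SectorLeg (sectorCount J') := fun i => (Ωe i).getD s with hτ''
  have hpE : p ∈ E := by simp [hE]
  have hEcard : E.card + 3 ≤ m + 1 := by
    have h' : E.card ≤ levelCount Ωe + 1 := card_legSet_le_levelCount_succ Ωe p
    omega
  have hEne : E.Nonempty := ⟨p, hpE⟩
  -- (1) the leg sum is dominated by the `E`-prescribed fine sum over `bgmSectorSet`
  have h1 : sectorLegSum ε (prescribedTuples (bgmSectorSet L M F' (m + 1)) Ωe) (sectorisedKernel L M β F' T (m + 1)) p s x ≤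
      ε ^ m * ∑ σ'' ∈ (bgmSectorSet L M F' (m + 1)).filter (fun σ'' => ∀ e ∈ E, σ'' e = τ'' e),
        ∑ x'' ∈ univ.filter (fun x'' : Fin (m + 1) → SpaceTimeIdx L M => x'' p = x),
          ‖sectorisedKernel L M β F' T (m + 1) σ'' x''‖ := by
    rw [sectorLegSum_def, ← mul_sum]
    refine mul_le_mul_of_nonneg_left (sum_le_sum_of_subset_of_nonneg ?_ fun _ _ _ => sum_nonneg fun _ _ => norm_nonneg _)
      (pow_nonneg hε0 m)
    intro Ω hΩ
    simp only [prescribedTuples, mem_filter] at hΩ ⊢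
    refine ⟨hΩ.1.1, fun e he => ?_⟩
    have he' : (Ωe e).isSome ∨ e = p := by simpa [hE] using he
    rcases he' with he' | rfl
    · obtain ⟨ℓ, hℓ⟩ := Option.isSome_iff_exists.1 he'
      rw [hτ'']
      simp only [hℓ, Option.getD_some]
      exact hΩ.1.2 e ℓ (by simp [hℓ])
    · show Ω e = (Ωe e).getD s
      rcases hcase : Ωe e with _ | ℓ
      · simpa using hΩ.2
      · simp only [Option.getD_some]
        exact hΩ.1.2 e ℓ (by simp [hcase])
  -- (2) the coarse `E`-prescribed sums are dominated by the coarse levelled norms of the same level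
  have hN₁ : ∀ (τ' : Fin (m + 1) → SectorLeg (sectorCount k)) (y : SpaceTimeIdx L M),
      ε ^ m * ∑ σ' ∈ univ.filter (fun σ' : Fin (m + 1) → SectorLeg (sectorCount k) => ∀ e ∈ E, σ' e = τ' e),
        ∑ x' ∈ univ.filter (fun x' : Fin (m + 1) → SpaceTimeIdx L M => x' p = y),
          ‖sectorisedKernel L M β Fk T (m + 1) σ' x'‖ ≤ N := by
    intro τ' y
    set Ωe' : Fin (m + 1) → Option (SectorLeg (sectorCount k)) := fun i => (Ωe i).map fun _ => τ' i with hΩe'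
    have hlev' : levelCount Ωe' = levelCount Ωe := levelCount_map_const Ωe τ'
    have hle : ε ^ m * ∑ σ' ∈ univ.filter (fun σ' : Fin (m + 1) → SectorLeg (sectorCount k) => ∀ e ∈ E, σ' e = τ' e),
        ∑ x' ∈ univ.filter (fun x' : Fin (m + 1) → SpaceTimeIdx L M => x' p = y), ‖sectorisedKernel L M β Fk T (m + 1) σ' x'‖ ≤
        sectorLegSum ε (prescribedTuples (bgmSectorSet L M Fk (m + 1)) Ωe') (sectorisedKernel L M β Fk T (m + 1)) p (τ' p) y := by
      rw [sectorLegSum_def, ← mul_sum]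
      refine mul_le_mul_of_nonneg_left ?_ (pow_nonneg hε0 m)
      have hsub : (bgmSectorSet L M Fk (m + 1)).filter (fun σ' : Fin (m + 1) → SectorLeg (sectorCount k) => ∀ e ∈ E, σ' e = τ' e) ⊆
          univ.filter (fun σ' : Fin (m + 1) → SectorLeg (sectorCount k) => ∀ e ∈ E, σ' e = τ' e) :=
        filter_subset_filter _ (subset_univ _)
      rw [← Finset.sum_subset hsub ?_]
      · refine sum_le_sum_of_subset_of_nonneg ?_ fun _ _ _ => sum_nonneg fun _ _ => norm_nonneg _
        intro σ' hσ'
        simp only [mem_filter, prescribedTuples] at hσ' ⊢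
        refine ⟨⟨hσ'.1, fun i ℓ hℓ => ?_⟩, hσ'.2 p hpE⟩
        have hi : (Ωe i).isSome := by
          rcases hcase : Ωe i with _ | ℓ₀
          · simp [hΩe', hcase] at hℓ
          · simp
        have hℓ' : ℓ = τ' i := by
          obtain ⟨ℓ₀, hℓ₀⟩ := Option.isSome_iff_exists.1 hi
          simp [hΩe', hℓ₀] at hℓ
          exact hℓ.symm
        rw [hℓ']
        exact hσ'.2 i (by simp [hE, hi])
      · intro σ' hσ'univ hσ'not
        have hP := (mem_filter.1 hσ'univ).2
        have hnot : σ' ∉ bgmSectorSet L M Fk (m + 1) := fun h => hσ'not (mem_filter.2 ⟨h, hP⟩)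
        exact sum_eq_zero fun x' _ => by rw [sectorisedKernel_eq_zero_of_not_mem_bgmSectorSet β Fk T hT hnot x', norm_zero]
    refine hle.trans ((sectorLegSum_le_sectorisedKernelNorm ε _ _ p (τ' p) y).trans ?_)
    have h := hN Ωe' hlev'
    rwa [klLevNormOf, hubbardSectorKernelNorm_def] at h
  -- (3) the re-sectorisation lemma with the empty on-class set and the absolute count
  have hX0 : (0 : ℝ) ≤ D ^ (m + 1) * ((J' : ℝ) + 1) * ((2 : ℝ) ^ J') ^ ((m + 1) - E.card - 2) := by positivity
  have h2 := hubbardSectorPrescribedSum_klAniso_jump_le_split (L := L) (M := M) hβ μ K hJ T hc₁0 hc₁r0 hX0 le_rfl hN0 le_rfl hcol₁ hrow₁ m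
    (bgmSectorSet L M F' (m + 1)) ∅ E τ'' p hpE (fun σ' _ => hcnt E τ'' σ' hEcard hEne) (fun σ' h => absurd h (Finset.notMem_empty _)) hN₁
    (fun τ' y => by simp) x
  -- (4) assemble
  refine h1.trans (h2.trans ?_)
  rw [zero_mul, add_zero]
  have harith := legSet_count_arith_abs hD J' m (levelCount Ωe) E.card (max_levelCount_one_le_card_legSet Ωe p) (card_legSet_le_succ Ωe p)
  have hrest : 0 ≤ c₁ ^ m * c₁r * ε ^ (m + 1) * N := by positivity
  calc c₁ ^ m * c₁r * (27 : ℝ) ^ E.card * ε ^ m * (ε * (D ^ (m + 1) * ((J' : ℝ) + 1) * ((2 : ℝ) ^ J') ^ ((m + 1) - E.card - 2) * N))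
      = (c₁ ^ m * c₁r * ε ^ (m + 1) * N * ((J' : ℝ) + 1)) * ((27 : ℝ) ^ E.card * (D ^ (m + 1) * ((2 : ℝ) ^ J') ^ ((m + 1) - E.card - 2))) := by ring
    _ ≤ (c₁ ^ m * c₁r * ε ^ (m + 1) * N * ((J' : ℝ) + 1)) * (D ^ (m + 1) * 27 ^ (m + 1) * ((2 : ℝ) ^ J') ^ ((m + 1) - max (levelCount Ωe) 1 - 2)) :=
        mul_le_mul_of_nonneg_left harith (mul_nonneg hrest hJ0)
    _ = c₁ ^ m * c₁r * ε ^ (m + 1) * (D ^ (m + 1) * 27 ^ (m + 1)) * ((J' : ℝ) + 1) * ((2 : ℝ) ^ J') ^ ((m + 1) - max (levelCount Ωe) 1 - 2) * N := by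
        ring

/-! ## §2 The jump under the stub binders, constants discharged -/

/-- **THE LEVELLED JUMP WITH THE SECOND CONSERVATION GAIN IN THE KL REGIME, ≥ 3 free legs, constants discharged** — under the binders of `stub_engine_step_norms` plus the
count's thresholds `c ≤ c₃′(R)`, `U ≤ U₀′(R)`: for every number of legs `m + 1` there is `C_m > 0` such that for every momentum-conserving `T`, scales
`k + 1 ≤ J′ ≤ nScales β + 1`, prescription `Ωe` with `levelCount Ωe + 4 ≤ m + 1` and bound `N` of the coarse levelled norms of the same level,
`klLevNormOf … J′ (m+1) T Ωe ≤ C_m·(J′+1)·(2^{J′})^{(m+1) − max(levelCount Ωe, 1) − 2}·N` (ABSOLUTE in `J′`).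
[cite: BenfattoGiulianiMastropietro2006, §2.8 (2.82)-(2.84), (2.88)-(2.90); BenfattoGiulianiMastropietro2003, §3.1 Lemma 3.1 (4.3)] -/
theorem klLevNormOf_jump_le_klEng_abs34 (m : ℕ) :
    ∃ C : ℝ, 0 < C ∧ ∀ R : RenConsts, R.WF2 → ∃ c₃' : ℝ, 0 < c₃' ∧ ∃ U₀' : ℝ, 0 < U₀' ∧
      ∀ (P : SplitConsts) (c : ℝ), P.WF → 0 < c → c ≤ klEngC₃6 P R → c ≤ c₃' →
      ∀ μ ∈ klWindowC, ∀ U : ℝ, 0 < U → U ≤ klEngU₀9 P R c → U ≤ U₀' → ∀ β : ℝ, klBetaMin ≤ β → β ≤ Real.exp (c / U ^ 2) →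
      ∀ K : TrigPolyC4v, FrameOK R U (nScales β) μ K → ∀ (L M : ℕ) [NeZero L] [NeZero M],
      klEngL₃ β U ≤ L → klEngM₃ β U L ≤ M → ∀ k J' : ℕ, k + 1 ≤ J' → J' ≤ nScales β + 1 →
      ∀ T : HubbardGrassmann L M,
        (∀ (m' : ℕ) (X : Fin m' → HubbardFieldIdx L M), ∑ i, signedMomentum L (X i).2 (X i).1.1.2 ≠ 0 → kernel ℂ T m' X = 0) →
      ∀ (Ωe : Fin (m + 1) → Option (SectorLeg (sectorCount J'))), levelCount Ωe + 4 ≤ m + 1 → ∀ (N : ℝ), 0 ≤ N →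
        (∀ Ωe' : Fin (m + 1) → Option (SectorLeg (sectorCount k)), levelCount Ωe' = levelCount Ωe →
          klLevNormOf L M β μ K k (m + 1) T Ωe' ≤ N) →
        klLevNormOf L M β μ K J' (m + 1) T Ωe ≤ C * ((J' : ℝ) + 1) * ((2 : ℝ) ^ J') ^ ((m + 1) - max (levelCount Ωe) 1 - 2) * N := by
  obtain ⟨CJ, hCJ, hov⟩ := overlap_jump_sums_klEng
  obtain ⟨D, hD, hreg⟩ := card_relCount34_prescribed_absUmklapp_klAniso_le_window
  refine ⟨(3 * CJ / 2) ^ (m + 1) * (D ^ (m + 1) * 27 ^ (m + 1)), by positivity, fun R hR2 => ?_⟩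
  have hRj : ∀ j, 0 ≤ R.Gfr j := gfr_nonneg_of_wf2 hR2
  obtain ⟨c₃, hc₃, U₀, hU₀, hcnt⟩ := hreg R hRj
  refine ⟨c₃, hc₃, U₀, hU₀, ?_⟩
  intro P c hP hc hc6 hc₃' μ hμ U hU hU9 hU₀' β hβmin hβc K hK L M _ _ hL3 hM3 k J' hJ hJN T hT Ωe hlev N hN0 hN
  have hβ : 0 < β := KLRegimeSplit.pos_of_klBetaMin_le hβmin
  obtain ⟨_, hcol₁, hrow₁⟩ := hov P R c hP hR2 hc hc6 μ hμ U hU hU9 β hβmin hβc K hK L M hL3 hM3 k J' hJ hJN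
  have hc₁0 : (0 : ℝ) ≤ 3 * CJ * M / β := by positivity
  have h := klLevNormOf_jump_le_of_consts_abs34 hβ μ K hJ T hT hc₁0 hc₁0 hD.le hcol₁ hrow₁ m
    (fun E τ'' σ' hE hEne => hcnt c hc hc₃' U hU hU₀' β hβmin hβc μ hμ μ K hK L M m k J' _ subset_rfl E τ'' σ' hE hEne) Ωe hlev hN0 hN
  have hMne : (M : ℝ) ≠ 0 := by exact_mod_cast NeZero.ne M
  have hεc : imagTimeWeight β M * (3 * CJ * M / β) = 3 * CJ / 2 := by
    unfold imagTimeWeight; field_simp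
  have hconst : (3 * CJ * M / β) ^ m * (3 * CJ * M / β) * imagTimeWeight β M ^ (m + 1) = (3 * CJ / 2) ^ (m + 1) := by
    rw [← pow_succ, ← mul_pow, mul_comm (3 * CJ * M / β), hεc]
  calc klLevNormOf L M β μ K J' (m + 1) T Ωe
      ≤ (3 * CJ * M / β) ^ m * (3 * CJ * M / β) * imagTimeWeight β M ^ (m + 1) * (D ^ (m + 1) * 27 ^ (m + 1)) * ((J' : ℝ) + 1) *
          ((2 : ℝ) ^ J') ^ ((m + 1) - max (levelCount Ωe) 1 - 2) * N := h
    _ = (3 * CJ / 2) ^ (m + 1) * (D ^ (m + 1) * 27 ^ (m + 1)) * ((J' : ℝ) + 1) * ((2 : ℝ) ^ J') ^ ((m + 1) - max (levelCount Ωe) 1 - 2) * N := by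
        rw [hconst]

/-! ## §3 The scale-`0` action re-measured at `F_{J′}`, 3–4 free legs -/

/-- **THE SCALE-`0` ACTION `𝒱_0[K]` RE-MEASURED AT `F_{J′}` WITH THE SECOND CONSERVATION GAIN, 3–4 free legs** (`1 ≤ J′ ≤ nScales β + 1`): at every prescription `Ωe` with
`levelCount Ωe + 4 ≤ m + 1`, `klLevNormOf … J′ (m+1) 𝒱_0 Ωe ≤ C_m·(J′+1)·(2^{J′})^{(m+1) − max(levelCount Ωe, 1) − 2}·N₀` whenever the level-`0` carriers
`klAnisoLegKernelNormAt … klE0 0 (m+1) Ωe′` of the same level are `≤ N₀` — the UV summand of `klTowerMeasLev_le_remeasured_sum` with growth `N^{L−3}` (plain norm)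
/ `N^{L−F−2}` (level `F ≥ 1`); its supplier is the level-`0` law. [cite: BenfattoGiulianiMastropietro2006, §2.8 (2.82)-(2.84); BenfattoGiulianiMastropietro2003, §3.1 Lemma 3.1 (4.3)] -/
theorem klLevNormOf_scaleZero_remeasure_le_klEng_abs34 (m : ℕ) :
    ∃ C : ℝ, 0 < C ∧ ∀ R : RenConsts, R.WF2 → ∃ c₃' : ℝ, 0 < c₃' ∧ ∃ U₀' : ℝ, 0 < U₀' ∧
      ∀ (P : SplitConsts) (c : ℝ), P.WF → 0 < c → c ≤ klEngC₃6 P R → c ≤ c₃' →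
      ∀ μ ∈ klWindowC, ∀ U : ℝ, 0 < U → U ≤ klEngU₀9 P R c → U ≤ U₀' → ∀ β : ℝ, klBetaMin ≤ β → β ≤ Real.exp (c / U ^ 2) →
      ∀ K : TrigPolyC4v, FrameOK R U (nScales β) μ K → ∀ (L M : ℕ) [NeZero L] [NeZero M],
      klEngL₃ β U ≤ L → klEngM₃ β U L ≤ M → ∀ J' : ℕ, 1 ≤ J' → J' ≤ nScales β + 1 →
      ∀ (Ωe : Fin (m + 1) → Option (SectorLeg (sectorCount J'))), levelCount Ωe + 4 ≤ m + 1 → ∀ (N₀ : ℝ), 0 ≤ N₀ →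
        (∀ Ωe' : Fin (m + 1) → Option (SectorLeg (sectorCount 0)), levelCount Ωe' = levelCount Ωe →
          klAnisoLegKernelNormAt L M β U μ K klE0 0 (m + 1) Ωe' ≤ N₀) →
        klLevNormOf L M β μ K J' (m + 1) (klEffectiveAction L M β U μ K klE0 0) Ωe ≤
          C * ((J' : ℝ) + 1) * ((2 : ℝ) ^ J') ^ ((m + 1) - max (levelCount Ωe) 1 - 2) * N₀ := by
  obtain ⟨C, hC, h⟩ := klLevNormOf_jump_le_klEng_abs34 m
  refine ⟨C, hC, fun R hR2 => ?_⟩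
  obtain ⟨c₃, hc₃, U₀, hU₀, h'⟩ := h R hR2
  refine ⟨c₃, hc₃, U₀, hU₀, ?_⟩
  intro P c hP hc hc6 hc₃' μ hμ U hU hU9 hU₀' β hβmin hβc K hK L M _ _ hL3 hM3 J' hJ1 hJN Ωe hlev N₀ hN0 hN
  exact h' P c hP hc hc6 hc₃' μ hμ U hU hU9 hU₀' β hβmin hβc K hK L M hL3 hM3 0 J' (by omega) hJN
    (klEffectiveAction L M β U μ K klE0 0) (klEffectiveAction_momentumConserving β U μ K klE0 0) Ωe hlev N₀ hN0
    (fun Ωe' hlev' => by rw [klLevNormOf_klEffectiveAction]; exact hN Ωe' hlev')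

end Summit.HubbardSuperconductivity.HubbardSuperconductivity.Theorems.EngineV8

end
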